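import Summits.PneNP.PneNP.Theorems.SoloBlindSparseStreaming
import Summits.PneNP.PneNP.Theorems.SoloBlindStreamingFooling
import HarnessLib

/-!
# One-pass space is the Myhill–Nerode class count (non-uniform `STREAM`)

Solo seat `solo-PneNP-blind` (blind mode); calibration of the necessary side of `PneNP`.
THEOREM E (`SoloBlindStreamingCompleteness`) states the summit as `∀ k, SAT ∉ USTREAM (N^k+k) (N^k+k)`;
THEOREM F / F♯ (`SoloBlindStreamingFooling`, `SoloBlindStreamingFoolingLinear`) prove the fragment
`space < (1/8 - δ) N` of that family by fooling sets, for every update time, uniformly or not.  This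
file records, in the kernel, the two-sided principle behind the claim that fooling / state-counting
arguments say EXACTLY what the non-uniform class `STREAM` is and nothing about uniform time:

* `NerodeStream.cls L N p` — the one-pass (Myhill–Nerode) CLASS of the prefix `p` at input length
  `N`: the prefixes `p'` of the same length that no common completion to length `N` separates from `p`
  w.r.t. `L`.
* **Upper bound** (`hasSpace_decides_of_summary`, `mem_STREAM_of_summary`): if some SUMMARY
  `q N p < 2 ^ m N` of prefixes of length `≤ N` is CLASS-SOUND (equal summaries of equal-length
  prefixes put them in one class), then `L ∈ STREAM S T` for every `S ≥ m + size + 1`, `T ≥ 5 S + 10`; the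
  state is `(position, summary of SOME equivalent prefix)` and the update map re-summarises a chosen
  representative — arbitrary update maps are allowed in the tree's model, and the time clause is free
  (`mem_STREAM_of_hasSpace`).  Class-count form (`mem_STREAM_of_classCount`): if at every level
  `i ≤ N` the prefixes of length `i` fall into `≤ 2 ^ m N` classes (a covering finset of
  representatives), the same conclusion holds.
* **Lower bound** (`card_lt_of_pairwise_inequivalent`, from THEOREM F's `card_lt_two_pow_of_fooling_STREAM`):
  if `L ∈ STREAM S T` then any finset of pairwise inequivalent prefixes of one length `i ≤ N`
  has `< 2 ^ (S N + 1)` elements.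

So for every language the optimal non-uniform one-pass space at length `N` is
`log₂ (max_i #classes(N, i))` up to an additive `size N + O(1)`, whatever the time bound: the exact
extent of what time-blind methods decide about the summit family.  (For `SAT` in the tree's code the
class count is `2^{N/8 + o(N)}` — classes are determined by the position, the family of clause-SETS
read so far and the pending literal — which is why THEOREM F♯'s rate `1/8` is the end of that road;
that count is not formalised here.)

References: J. E. Hopcroft, J. D. Ullman, *Introduction to Automata Theory, Languages, and
Computation* (1979), §3.4 (Myhill–Nerode theorem); E. Kushilevitz, N. Nisan, *Communication
Complexity* (1997), §1.3 (fooling sets, one-way complexity); the streaming model is that of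
D. M. McKay, C. D. Murray, R. R. Williams, STOC 2019, §2 [doi:10.1145/3313276.3316396].
-/

namespace Summit.PneNP.PneNP.Theorems

open Literature.Computability.Complexity Literature.Computability.MetaComplexity
open Literature.Computability.MetaComplexity.McKayMurrayWilliams2019

namespace SoloBlind

namespace NerodeStream

variable (L : Language Bool)

/-- **One-pass equivalence class at input length `N`**: `cls L N p` is the set of prefixes `p'` of
the same length as `p` such that for every completion `z` to total length `N`,
`p ++ z ∈ L ↔ p' ++ z ∈ L`. [Hopcroft–Ullman 1979, §3.4 (Myhill–Nerode right congruence)] [folklore] -/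
def cls (N : ℕ) (p : List Bool) : Set (List Bool) :=
  {p' | p.length = p'.length ∧
    ∀ z : List Bool, p.length + z.length = N → (p ++ z ∈ L ↔ p' ++ z ∈ L)}

variable {L}

/-- Unfolding membership in a class. [folklore] -/
theorem mem_cls_iff {N : ℕ} {p p' : List Bool} :
    p' ∈ cls L N p ↔ p.length = p'.length ∧
      ∀ z : List Bool, p.length + z.length = N → (p ++ z ∈ L ↔ p' ++ z ∈ L) := Iff.rfl

/-- Every prefix lies in its own class. [folklore] -/
theorem mem_cls_self {N : ℕ} {p : List Bool} : p ∈ cls L N p :=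
  mem_cls_iff.2 ⟨_root_.rfl, fun _ _ => Iff.rfl⟩

/-- Classes are symmetric. [folklore] -/
theorem mem_cls_symm {N : ℕ} {p p' : List Bool} (h : p' ∈ cls L N p) : p ∈ cls L N p' := by
  obtain ⟨hl, hz⟩ := mem_cls_iff.1 h
  exact mem_cls_iff.2 ⟨hl.symm, fun z hz' => (hz z (by rw [hl]; exact hz')).symm⟩

/-- Classes are transitive. [folklore] -/
theorem mem_cls_trans {N : ℕ} {p p' p'' : List Bool} (h : p' ∈ cls L N p) (h' : p'' ∈ cls L N p') :
    p'' ∈ cls L N p := by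
  obtain ⟨hl, hz⟩ := mem_cls_iff.1 h
  obtain ⟨hl', hz'⟩ := mem_cls_iff.1 h'
  exact mem_cls_iff.2 ⟨hl.trans hl', fun z hzN => (hz z hzN).trans (hz' z (by rw [← hl]; exact hzN))⟩

/-- Right congruence: classes are preserved under appending the same word. [folklore] -/
theorem append_mem_cls {N : ℕ} {p p' : List Bool} (h : p' ∈ cls L N p) (x : List Bool) :
    p' ++ x ∈ cls L N (p ++ x) := by
  obtain ⟨hl, hz⟩ := mem_cls_iff.1 h
  refine mem_cls_iff.2 ⟨by simp [hl], fun z hzN => ?_⟩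
  simp only [List.append_assoc]
  exact hz (x ++ z) (by simp only [List.length_append] at hzN ⊢; omega)

/-- At full length, words in one class agree on membership. [folklore] -/
theorem mem_iff_of_mem_cls {N : ℕ} {p p' : List Bool} (h : p' ∈ cls L N p) (hp : p.length = N) :
    (p ∈ L ↔ p' ∈ L) := by
  obtain ⟨-, hz⟩ := mem_cls_iff.1 h
  simpa using hz [] (by simpa using hp)

/-- Words in one class have the same length. [folklore] -/
theorem length_eq_of_mem_cls {N : ℕ} {p p' : List Bool} (h : p' ∈ cls L N p) :
    p'.length = p.length := (mem_cls_iff.1 h).1.symm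

/-! ### The class-index streaming algorithm -/

variable (L) (q : ℕ → List Bool → ℕ) (m : ℕ → ℕ)

/-- The state encoding of `(position i, summary s)` at input length `N`:
`true :: ` the `(m N + size N)`-bit code of `s + 2^{m N} · i`. [folklore] -/
def enc (N i s : ℕ) : List Bool :=
  true :: SparseStream.toBits (m N + Nat.size N) (s + 2 ^ m N * i)

open Classical in
/-- Some prefix of length `i` with summary `s` (or `[]` if there is none). [folklore] -/
noncomputable def rep (N i s : ℕ) : List Bool :=
  if h : ∃ p : List Bool, p.length = i ∧ q N p = s then Classical.choose h else []

/-- The update map: decode `(i, s)`, re-summarise `rep i s ++ [b]`, re-encode with position `i + 1`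
(dead state `[]` on malformed states). [folklore] -/
noncomputable def upd (N : ℕ) (st : List Bool) (b : Bool) : List Bool :=
  match st with
  | [] => []
  | _ :: bits =>
    if SparseStream.ofBits bits / 2 ^ m N < N then
      enc m N (SparseStream.ofBits bits / 2 ^ m N + 1)
        (q N (rep q N (SparseStream.ofBits bits / 2 ^ m N) (SparseStream.ofBits bits % 2 ^ m N) ++ [b]))
    else []

open Classical in
/-- Acceptance: some word of length `N` with the recorded summary lies in `L`. [folklore] -/
noncomputable def acc (N : ℕ) (st : List Bool) : Bool :=
  match st with
  | [] => false
  | _ :: bits => decide (∃ p : List Bool, p.length = N ∧ q N p = SparseStream.ofBits bits % 2 ^ m N ∧ p ∈ L)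

/-- The class-index one-pass streaming algorithm for `L` with summary `q` and bit budget `m`.
[folklore] -/
noncomputable def alg : StreamingAlgorithm where
  init N := enc m N 0 (q N [])
  update N st b := upd q m N st b
  accept N st := acc L q m N st

variable {L q m}

/-- Encoded states have length `m N + size N + 1`. [folklore] -/
@[simp] theorem length_enc (N i s : ℕ) : (enc m N i s).length = m N + Nat.size N + 1 := by
  simp [enc]

/-- Updated states have length `≤ m N + size N + 1`. [folklore] -/
theorem length_upd_le (N : ℕ) (st : List Bool) (b : Bool) :
    (upd q m N st b).length ≤ m N + Nat.size N + 1 := by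
  cases st with
  | nil => simp [upd]
  | cons a bits =>
    simp only [upd]
    split_ifs <;> simp

/-- The algorithm has space `S` for every `S ≥ m + size + 1`. [folklore] -/
theorem hasSpace {S : ℕ → ℕ} (hS : ∀ N, m N + Nat.size N + 1 ≤ S N) : (alg L q m).HasSpace S :=
  fun N => ⟨(length_enc (m := m) N 0 (q N [])).le.trans (hS N),
    fun st b _ => (length_upd_le (q := q) (m := m) N st b).trans (hS N)⟩

/-- The code of `(i, s)` fits in `m N + size N` bits when `s < 2^{m N}` and `i ≤ N`. [folklore] -/
theorem code_lt {N i s : ℕ} (hs : s < 2 ^ m N) (hi : i ≤ N) :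
    s + 2 ^ m N * i < 2 ^ (m N + Nat.size N) := by
  have h1 : N < 2 ^ Nat.size N := Nat.lt_size_self N
  have h2 : s + 2 ^ m N * i < 2 ^ m N * 2 ^ Nat.size N :=
    calc s + 2 ^ m N * i
        < 2 ^ m N + 2 ^ m N * i := by omega
      _ = 2 ^ m N * (i + 1) := by ring
      _ ≤ 2 ^ m N * 2 ^ Nat.size N := Nat.mul_le_mul_left _ (by omega)
  simpa [pow_add] using h2

/-- Decoding the position. [folklore] -/
theorem div_code {N i s : ℕ} (hs : s < 2 ^ m N) : (s + 2 ^ m N * i) / 2 ^ m N = i := by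
  rw [Nat.add_mul_div_left _ _ (by positivity), Nat.div_eq_of_lt hs, zero_add]

/-- Decoding the summary. [folklore] -/
theorem mod_code {N i s : ℕ} (hs : s < 2 ^ m N) : (s + 2 ^ m N * i) % 2 ^ m N = s := by
  rw [Nat.add_mul_mod_self_left, Nat.mod_eq_of_lt hs]

/-- The update map on a well-formed state. [folklore] -/
theorem upd_enc {N i s : ℕ} (hs : s < 2 ^ m N) (hi : i < N) (b : Bool) :
    upd q m N (enc m N i s) b = enc m N (i + 1) (q N (rep q N i s ++ [b])) := by
  have hv : SparseStream.ofBits (SparseStream.toBits (m N + Nat.size N) (s + 2 ^ m N * i)) =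
      s + 2 ^ m N * i := SparseStream.ofBits_toBits (code_lt hs hi.le)
  show upd q m N (true :: _) b = _
  simp only [upd, hv, div_code hs, mod_code hs, hi, ↓reduceIte]

/-- Acceptance on a well-formed final state. [folklore] -/
theorem acc_enc_iff {N s : ℕ} (hs : s < 2 ^ m N) :
    acc L q m N (enc m N N s) = true ↔ ∃ p : List Bool, p.length = N ∧ q N p = s ∧ p ∈ L := by
  have hv : SparseStream.ofBits (SparseStream.toBits (m N + Nat.size N) (s + 2 ^ m N * N)) =
      s + 2 ^ m N * N := SparseStream.ofBits_toBits (code_lt hs le_rfl)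
  show acc L q m N (true :: _) = true ↔ _
  simp only [acc, decide_eq_true_eq]
  rw [hv, mod_code hs]

variable (L q m) in
/-- The good states for the actual prefix `p` (run invariant): the codes of
`(|p|, summary of SOME prefix in the class of p)`. [folklore] -/
def goodStates (N : ℕ) (p : List Bool) : Set (List Bool) :=
  {st | ∃ p' ∈ cls L N p, st = enc m N p.length (q N p')}

/-- Unfolding membership in `goodStates`. [folklore] -/
theorem mem_goodStates_iff {N : ℕ} {p st : List Bool} :
    st ∈ goodStates L q m N p ↔ ∃ p' ∈ cls L N p, st = enc m N p.length (q N p') := Iff.rfl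

/-- The initial state is good for the empty prefix. [folklore] -/
theorem good_init (N : ℕ) : (alg L q m).init N ∈ goodStates L q m N [] :=
  mem_goodStates_iff.2 ⟨[], mem_cls_self, rfl⟩

/-- One update step preserves the invariant. [folklore] -/
theorem good_upd (hq : ∀ N (p p' : List Bool), p.length = p'.length → p.length ≤ N → q N p = q N p' → p' ∈ cls L N p)
    (hlt : ∀ N (p : List Bool), p.length ≤ N → q N p < 2 ^ m N) {N : ℕ} {p st : List Bool}
    (hg : st ∈ goodStates L q m N p) (hp : p.length < N) (b : Bool) :
    (alg L q m).update N st b ∈ goodStates L q m N (p ++ [b]) := by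
  obtain ⟨p', he, rfl⟩ := mem_goodStates_iff.1 hg
  have hlen : p'.length = p.length := length_eq_of_mem_cls he
  have hs : q N p' < 2 ^ m N := hlt N p' (by omega)
  have hex : ∃ p'' : List Bool, p''.length = p.length ∧ q N p'' = q N p' := ⟨p', hlen, rfl⟩
  have hrep : rep q N p.length (q N p') = Classical.choose hex := by
    unfold rep
    rw [dif_pos hex]
  obtain ⟨hl'', hq''⟩ := Classical.choose_spec hex
  -- `p'` lies in the class of the chosen representative, hence so does `p`'s class contain it
  have h1 : p' ∈ cls L N (Classical.choose hex) :=
    hq N (Classical.choose hex) p' (by omega) (by omega) hq''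
  have h2 : Classical.choose hex ∈ cls L N p := mem_cls_trans he (mem_cls_symm h1)
  have h3 : Classical.choose hex ++ [b] ∈ cls L N (p ++ [b]) := append_mem_cls h2 [b]
  refine mem_goodStates_iff.2 ⟨Classical.choose hex ++ [b], h3, ?_⟩
  show upd q m N (enc m N p.length (q N p')) b =
    enc m N (p ++ [b]).length (q N (Classical.choose hex ++ [b]))
  rw [upd_enc hs hp, hrep, List.length_append, List.length_singleton]

/-- Runs preserve the invariant. [folklore] -/
theorem good_runFrom (hq : ∀ N (p p' : List Bool), p.length = p'.length → p.length ≤ N → q N p = q N p' → p' ∈ cls L N p)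
    (hlt : ∀ N (p : List Bool), p.length ≤ N → q N p < 2 ^ m N) {N : ℕ} {p st : List Bool}
    (hg : st ∈ goodStates L q m N p) (x : List Bool) (hpx : p.length + x.length ≤ N) :
    (alg L q m).runFrom N st x ∈ goodStates L q m N (p ++ x) := by
  induction x generalizing p st with
  | nil => simpa [StreamingAlgorithm.runFrom] using hg
  | cons b x ih =>
    have hp : p.length < N := by simp only [List.length_cons] at hpx; omega
    have hstep : (alg L q m).update N st b ∈ goodStates L q m N (p ++ [b]) :=
      good_upd hq hlt hg hp b
    have hpx' : (p ++ [b]).length + x.length ≤ N := by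
      simp only [List.length_cons, List.length_append, List.length_nil] at hpx ⊢
      omega
    have := ih hstep hpx'
    simpa [StreamingAlgorithm.runFrom, List.append_assoc] using this

/-- **The class-index algorithm decides `L`** (for a class-sound, bounded summary). [folklore] -/
theorem decides (hq : ∀ N (p p' : List Bool), p.length = p'.length → p.length ≤ N → q N p = q N p' → p' ∈ cls L N p)
    (hlt : ∀ N (p : List Bool), p.length ≤ N → q N p < 2 ^ m N) : (alg L q m).Decides L := by
  intro x
  have hgood : (alg L q m).finalState x ∈ goodStates L q m x.length x := by
    have := good_runFrom hq hlt (good_init (L := L) (q := q) (m := m) x.length) x (by simp)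
    rw [List.nil_append] at this
    exact this
  obtain ⟨p', he, hst⟩ := mem_goodStates_iff.1 hgood
  have hlen : p'.length = x.length := length_eq_of_mem_cls he
  have hs : q x.length p' < 2 ^ m x.length := hlt _ _ hlen.le
  simp only [StreamingAlgorithm.Accepts, hst]
  show acc L q m x.length (enc m x.length x.length (q x.length p')) = true ↔ x ∈ L
  rw [acc_enc_iff hs]
  constructor
  · rintro ⟨p, hpN, hpq, hpL⟩
    have h1 : p' ∈ cls L x.length p := hq _ p p' (by omega) (by omega) hpq
    have h2 : p ∈ cls L x.length x := mem_cls_trans he (mem_cls_symm h1)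
    exact (mem_iff_of_mem_cls h2 rfl).2 hpL
  · intro hx
    exact ⟨p', hlen, rfl, (mem_iff_of_mem_cls he rfl).1 hx⟩

/-! ### Class representatives as a summary -/

variable (L) (R : ℕ → ℕ → Finset (List Bool))

open Classical in
/-- The index, in the listing of `R N |p|`, of some representative equivalent to `p` (else `0`).
[folklore] -/
noncomputable def idx (N : ℕ) (p : List Bool) : ℕ :=
  if h : ∃ j, j < (R N p.length).toList.length ∧ (R N p.length).toList.getD j [] ∈ cls L N p
  then Classical.choose h else 0

variable {L R}

/-- If `R N |p|` contains a representative of `p`, the index points at one and is `< |R N |p||`.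
[folklore] -/
theorem idx_spec {N : ℕ} {p : List Bool} (h : ∃ r ∈ R N p.length, r ∈ cls L N p) :
    idx L R N p < (R N p.length).card ∧
      (R N p.length).toList.getD (idx L R N p) [] ∈ cls L N p := by
  have h' : ∃ j, j < (R N p.length).toList.length ∧
      (R N p.length).toList.getD j [] ∈ cls L N p := by
    obtain ⟨r, hr, hpr⟩ := h
    obtain ⟨j, hj, hjr⟩ := List.mem_iff_getElem.mp (Finset.mem_toList.mpr hr)
    refine ⟨j, hj, ?_⟩
    rw [List.getD_eq_getElem?_getD, List.getElem?_eq_getElem hj, Option.getD_some, hjr]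
    exact hpr
  have hidx : idx L R N p = Classical.choose h' := by
    unfold idx
    rw [dif_pos h']
  rw [hidx]
  obtain ⟨hj, hpe⟩ := Classical.choose_spec h'
  exact ⟨by simpa [Finset.length_toList] using hj, hpe⟩

/-- The index never exceeds the cardinality of the representative set (and is `0` when that set
is useless). [folklore] -/
theorem idx_lt_two_pow {N : ℕ} {p : List Bool} {K : ℕ} (hK : (R N p.length).card ≤ 2 ^ K) :
    idx L R N p < 2 ^ K := by
  by_cases h : ∃ j, j < (R N p.length).toList.length ∧
      (R N p.length).toList.getD j [] ∈ cls L N p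
  · have hidx : idx L R N p = Classical.choose h := by
      unfold idx
      rw [dif_pos h]
    rw [hidx]
    have h1 := (Classical.choose_spec h).1
    have h2 : (R N p.length).toList.length = (R N p.length).card := Finset.length_toList _
    omega
  · have hidx : idx L R N p = 0 := by
      unfold idx
      rw [dif_neg h]
    rw [hidx]
    positivity

end NerodeStream

open NerodeStream

/-- **Upper bound, summary form.** A class-sound summary with `< 2^{m N}` values on prefixes of
length `≤ N` yields a one-pass streaming algorithm for `L` with space `S`, for every
`S ≥ m + size + 1`. [Hopcroft–Ullman 1979, §3.4] [folklore] -/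
theorem hasSpace_decides_of_summary {L : Language Bool} {m : ℕ → ℕ} (q : ℕ → List Bool → ℕ)
    (hq : ∀ N (p p' : List Bool), p.length = p'.length → p.length ≤ N → q N p = q N p' → p' ∈ cls L N p)
    (hlt : ∀ N (p : List Bool), p.length ≤ N → q N p < 2 ^ m N)
    {S : ℕ → ℕ} (hS : ∀ N, m N + Nat.size N + 1 ≤ S N) :
    ∃ A : StreamingAlgorithm, A.HasSpace S ∧ A.Decides L :=
  ⟨NerodeStream.alg L q m, NerodeStream.hasSpace hS, NerodeStream.decides hq hlt⟩

/-- **Upper bound, summary form, as membership in `STREAM S T`** (`T ≥ 5 S + 10`; the time clause is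
free in the tree's non-uniform model). [Hopcroft–Ullman 1979, §3.4] [folklore] -/
theorem mem_STREAM_of_summary {L : Language Bool} {m : ℕ → ℕ} (q : ℕ → List Bool → ℕ)
    (hq : ∀ N (p p' : List Bool), p.length = p'.length → p.length ≤ N → q N p = q N p' → p' ∈ cls L N p)
    (hlt : ∀ N (p : List Bool), p.length ≤ N → q N p < 2 ^ m N)
    {S T : ℕ → ℕ} (hS : ∀ N, m N + Nat.size N + 1 ≤ S N) (hT : ∀ N, 5 * S N + 10 ≤ T N) :
    L ∈ STREAM S T :=
  mem_STREAM_of_hasSpace (hasSpace_decides_of_summary q hq hlt hS) hT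

/-- **Upper bound, class-count form.** If for every input length `N` and level `i ≤ N` the prefixes
of length `i` are covered, up to one-pass equivalence, by a finset of `≤ 2^{m N}` representatives,
then `L ∈ STREAM S T` for all `S ≥ m + size + 1`, `T ≥ 5 S + 10`.
[Hopcroft–Ullman 1979, §3.4; Kushilevitz–Nisan 1997, §1.3] [folklore] -/
theorem mem_STREAM_of_classCount {L : Language Bool} {m : ℕ → ℕ}
    (h : ∀ N i, ∃ R : Finset (List Bool), R.card ≤ 2 ^ m N ∧
      (i ≤ N → ∀ p : List Bool, p.length = i → ∃ r ∈ R, r ∈ NerodeStream.cls L N p))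
    {S T : ℕ → ℕ} (hS : ∀ N, m N + Nat.size N + 1 ≤ S N) (hT : ∀ N, 5 * S N + 10 ≤ T N) :
    L ∈ STREAM S T := by
  choose R hcard hcov using h
  refine mem_STREAM_of_summary (NerodeStream.idx L R) ?_ ?_ hS hT
  · intro N p p' hlen hle hqq
    obtain ⟨-, hp⟩ := NerodeStream.idx_spec (L := L) (R := R) (hcov N p.length hle p rfl)
    obtain ⟨-, hp'⟩ := NerodeStream.idx_spec (L := L) (R := R) (hcov N p'.length (hlen ▸ hle) p' rfl)
    rw [← hqq, ← hlen] at hp'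
    exact NerodeStream.mem_cls_trans hp (NerodeStream.mem_cls_symm hp')
  · intro N p hle
    exact NerodeStream.idx_lt_two_pow (hcard N p.length)

/-- **Lower bound, class form** (THEOREM F's fooling bound restated): if `L ∈ STREAM S T` then
pairwise one-pass-inequivalent prefixes of one length `i ≤ N` number `< 2^(S N + 1)`.
[Kushilevitz–Nisan 1997, §1.3] [folklore] -/
theorem card_lt_of_pairwise_inequivalent {S T : ℕ → ℕ} {L : Language Bool} (hmem : L ∈ STREAM S T)
    {N i : ℕ} (hi : i ≤ N) (R : Finset (List Bool)) (hlen : ∀ r ∈ R, r.length = i)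
    (hsep : ∀ r ∈ R, ∀ r' ∈ R, r ≠ r' → r' ∉ NerodeStream.cls L N r) :
    R.card < 2 ^ (S N + 1) := by
  have key := card_lt_two_pow_of_fooling_STREAM hmem (N := N) (ι := R) (fun r => (r : List Bool))
    (fun r => by rw [hlen r r.2]; exact hi) (by
      intro r r' hne
      have hne' : (r : List Bool) ≠ r' := fun h => hne (Subtype.ext h)
      have hl : (r : List Bool).length = (r' : List Bool).length := by
        rw [hlen r r.2, hlen r' r'.2]
      have hns : ¬ ∀ z : List Bool, (r : List Bool).length + z.length = N →
          ((r : List Bool) ++ z ∈ L ↔ (r' : List Bool) ++ z ∈ L) :=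
        fun hall => hsep r r.2 r' r'.2 hne' (NerodeStream.mem_cls_iff.2 ⟨hl, hall⟩)
      obtain ⟨z, hz⟩ := not_forall.mp hns
      obtain ⟨hzN, hiff⟩ := Classical.not_imp.mp hz
      refine ⟨z, by simp only [List.length_append]; omega, ?_, hiff⟩
      simp only [List.length_append]; rw [← hl]; omega)
  simpa using key

/-- **Lower bound, exponent form**: `2^k` pairwise inequivalent prefixes of one length force
`k < S N + 1` for every `STREAM S T ∋ L`. [folklore] -/
theorem lt_space_of_pairwise_inequivalent {S T : ℕ → ℕ} {L : Language Bool} (hmem : L ∈ STREAM S T)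
    {N i k : ℕ} (hi : i ≤ N) (R : Finset (List Bool)) (hcard : 2 ^ k ≤ R.card)
    (hlen : ∀ r ∈ R, r.length = i) (hsep : ∀ r ∈ R, ∀ r' ∈ R, r ≠ r' → r' ∉ NerodeStream.cls L N r) :
    k < S N + 1 :=
  (Nat.pow_lt_pow_iff_right (by norm_num)).1
    (lt_of_le_of_lt hcard (card_lt_of_pairwise_inequivalent hmem hi R hlen hsep))

end SoloBlind

end Summit.PneNP.PneNP.Theorems
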